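import Summits.RiemannHypothesis.RiemannHypothesis.Theorems.Splittings.JensenX4CleanSplit
import HarnessLib

/-!
# Row L38 — `XiPrimeOnLine ∧ LaguerreSignAtCriticalPoints ⟺ RH` (route LaguerreSpeiserSplit, UNCONDITIONAL row)

Cell rh-split, lead g9 RULINGS #332 (c)(2) / #358 (e); LINE «CLEAN NEAR FIELD» = L38 of record (ideator rh-idea-2 g2,
critic PASS-WITH-PRICE 23:01:26Z, director-rh 23:01:59Z 2026-08-27).  The gate re-rendered
`Theses/LaguerreSpeiserSplit.lean` (sha16 a9def53fb9fceda9) with the support item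
`LaguerreSignAtCriticalPoints` (stmt-RiemannHypothesis-23196, «C′»: at every real critical point `c` of
`t ↦ Re Ξ(t)` off the zeros of `Ξ` one has `Ξ(c)·(Re Ξ)″(c) < 0`), whose body is — character for character — the
second conjunct of the tree KERNEL theorem
`Theorems.Splittings.JensenX4CleanSplit.rh_iff_xiPrimeOnLine_and_laguerreAtCriticalPoints : RH ↔ XiPrimeOnLine ∧ C′`
(rh-splitx-theory-1 g3, T18).  This file states the ROW over the route decls BY NAME:

* `laguerreSignAtCriticalPoints_of_rh : RH → LaguerreSignAtCriticalPoints` (by name from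
  `JensenX4CleanSplit.laguerreAtCriticalPoints_of_rh`);
* `xiPrimeOnLine_and_laguerreSignAtCriticalPoints_iff_rh : (XiPrimeOnLine ∧ LaguerreSignAtCriticalPoints) ↔ RH`.

Both conjuncts are RH-implied open statements (`XiPrimeOnLine` = stmt-18896, crux; `LaguerreSignAtCriticalPoints` =
stmt-23196); neither alone is known to give RH (rh-idea-2's BC2 probes; separating models `(z²+b²)cos z`, `b ≷ √2`).
The one-way seam `XiPrimeOnLine → LaguerreSignAtCriticalPoints → RH` is filed separately as the route's alt-closer
candidate (`Theorems/LaguerreSpeiserSplitAltClosers.lean`, RULING #352 (a)(1)).  Standard axioms; no `def`s.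
Supports stmt-RiemannHypothesis-23196 without closing it.

HONEST LABEL: «SPLITTING SEARCH over kernel-typed RH-EQUIVALENCES; a splitting A ∧ B ⟹ RH is CONDITIONAL bookkeeping
unless A and B are both proved; nothing here bears on the truth of RH.»
-/

-- D-0017: `Summit.RiemannHypothesis.RiemannHypothesis.…` duplicates the namespace BY DESIGN (single-problem summit).
set_option linter.dupNamespace false

namespace Summit.RiemannHypothesis.RiemannHypothesis.Theorems.Splittings.LaguerreCleanNearFieldRow

open Summit.RiemannHypothesis.RiemannHypothesis.Theses.LaguerreSpeiserSplit (XiPrimeOnLine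
  LaguerreSignAtCriticalPoints)
open Summit.RiemannHypothesis.RiemannHypothesis.Theorems.Splittings.JensenX4CleanSplit
  (laguerreAtCriticalPoints_of_rh rh_iff_xiPrimeOnLine_and_laguerreAtCriticalPoints)

/-- **RH ⟹ `LaguerreSignAtCriticalPoints`** (C′ is a consequence of RH — census, not news): by name from
`JensenX4CleanSplit.laguerreAtCriticalPoints_of_rh` (the level-`0` instance of the Laguerre–Pólya heredity of `Ξ`
under RH); the route decl unfolds to that theorem's conclusion verbatim. -/
theorem laguerreSignAtCriticalPoints_of_rh (hRH : RiemannHypothesis) : LaguerreSignAtCriticalPoints :=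
  laguerreAtCriticalPoints_of_rh hRH

/-- **ROW L38 (the splitting, unconditional — the seam is a kernel theorem, no named fact)**:
`(XiPrimeOnLine ∧ LaguerreSignAtCriticalPoints) ↔ RiemannHypothesis`, i.e. the tree's
`JensenX4CleanSplit.rh_iff_xiPrimeOnLine_and_laguerreAtCriticalPoints` read over the route decls (shape of rows
X-11 / X-16 / X-17).  Conditional bookkeeping value only: both conjuncts are RH-implied OPEN statements
(stmt-RiemannHypothesis-18896, stmt-RiemannHypothesis-23196); nothing here bears on the truth of RH. -/
theorem xiPrimeOnLine_and_laguerreSignAtCriticalPoints_iff_rh :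
    (XiPrimeOnLine ∧ LaguerreSignAtCriticalPoints) ↔ RiemannHypothesis :=
  rh_iff_xiPrimeOnLine_and_laguerreAtCriticalPoints.symm

end Summit.RiemannHypothesis.RiemannHypothesis.Theorems.Splittings.LaguerreCleanNearFieldRow
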